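import Mathlib
import HarnessLib
import Summits.HubbardSuperconductivity.HubbardSuperconductivity.Theorems.KLProgrammeKLRegimeSectorSliceIncrPairMoment
import Summits.HubbardSuperconductivity.HubbardSuperconductivity.Theorems.KLProgrammeKLRegimeSectorSliceIncrRates

/-!
# Route `KLProgramme` — engine support (route (L2), FIRST MOMENT, cure (c-D)): the increment pair bound with the RATES SOLVED — the per-pair
# weighted `ℓ¹` norm of `Sᵀ(F)(C^{K′} − C^{K})S(F)` for a pair of frames in the TWO-SCALE CLASS of a flow piece

Cell `gate-hubbard-kl`, seat hubbard-kl-k3c3-p2 (g9), for the ENGINE child stmt-HubbardSuperconductivity-20437 (`stub_engine_step_norms`, WEIGHTED lines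
at internal levels; v2 conditional token #19; located risk «(b)-Wt@j≥1», evidence #48 CD-LIMITS §1).  `…SectorSliceIncrPairMoment.sliceIncrPairWt_charSum_l1_le`
leaves the amplitude `A₀` and the five rates free, subject to six inequalities.  Here they are CHOSEN (Benfatto–Giuliani–Mastropietro 2006 §3 (3.2)–(3.8),
one flow piece at depth `x = 4^m`): if the band increment `v = e_{K′} − e_K` has `|v| ≤ G₀/x²`, `‖Dv‖ ≤ G₁/x`, `‖D²v‖ ≤ G₂`, `‖D³v‖ ≤ G₃x` and the band of
`K` has `‖De‖ ≤ b₁`, `‖D²e‖ ≤ b₂ + b₂′x`, `‖D³e‖ ≤ b₃ + b₃′x` (`x ≥ 1`), and the multiplier's space differences are in SCALE FORM `‖Δ^k_w M‖ ≤ α_k‖w‖^k`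
(axes, normal, tangent; isotropic), then with `A₀ = 2c₀K₁P₀`, space rates `ρ/x` (order three; `|v|`-scaled in the normal/tangent directions) and
`ρ₃/x` (order two along the sector), time rate `s₀`, and NO finite-volume cut (`R₀ = 0`):

* **`sliceIncrPairWt_charSum_l1_le_twoScale`** — `Σ_z (1 + s₀|t| + (ρ/x)(|x₀|+|x₁|))·‖Ŝ(z)‖ ≤ x·√(524288(1/s₀+1)[(1+4√2)²(2√2/ρ+2)(2√2/ρ₃+2) + (1/ρ+1)²])
  · √(24·2M·L²·N_s) · 2c₀K₁G₀/x²`, given the level time condition, the five threshold conditions of `…SectorSliceIncrRates` (monotone in `x`) and the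
  `x`-free rate conditions `G₃ρ³ ≤ (2/π)³G₀`, `G₂ρ₃² ≤ (2/π)²G₀`.  Net size `∝ x⁻¹` per piece at the piece's own weight rate `ρ/x`.

Everything is proved; no definitions, no named facts. [folklore]

References: G. Benfatto, A. Giuliani, V. Mastropietro, Ann. Henri Poincaré 7 (2006) 809–898, §2.8 (2.81), §3 (3.2)–(3.8).
-/

noncomputable section

namespace Summit.HubbardSuperconductivity.HubbardSuperconductivity.Theorems.TorusFourierL2

set_option linter.dupNamespace false -- summit = problem name (single-conjunct summit), D-0017

open Finset Complex Literature.MathematicalPhysics.QuantumLattice Literature.Probability.LatticeModels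
open Summit.HubbardSuperconductivity.HubbardSuperconductivity.Theorems.DispersionFlow
open scoped Real

section Pair

variable {L M : ℕ} [NeZero L] [NeZero M]

/-- A nonzero integer vector has positive Euclidean length. [folklore] -/
theorem sqrt_sq_add_sq_pos_of_ne_zero (v : Fin 2 → ℤ) (hv : v ≠ 0) : 0 < Real.sqrt ((v 0 : ℝ) ^ 2 + (v 1 : ℝ) ^ 2) := by
  apply Real.sqrt_pos.2
  by_contra h
  push Not at h
  have h0 : (v 0 : ℝ) = 0 := by nlinarith only [h, sq_nonneg (v 0 : ℝ), sq_nonneg (v 1 : ℝ)]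
  have h1 : (v 1 : ℝ) = 0 := by nlinarith only [h, sq_nonneg (v 0 : ℝ), sq_nonneg (v 1 : ℝ)]
  apply hv
  funext j
  fin_cases j
  · exact_mod_cast h0
  · exact_mod_cast h1

/-- **The increment pair bound in the two-scale class of a flow piece, rates solved** (see the module docstring; it instantiates the six explicit
rate inequalities of `sliceIncrPairWt_charSum_l1_le` with `…SectorSliceIncrRates`). [cite: BenfattoGiulianiMastropietro2006, §2.8 (2.81), §3 (3.2)–(3.8)] -/
theorem sliceIncrPairWt_charSum_l1_le_twoScale {β μ Λ Λ' : ℝ} {K K' : TrigPolyC4v} (hβ : 0 < β) (hΛ : 0 < Λ) (hΛΛ' : Λ ≤ Λ')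
    (hM : Λ' < π * (2 * M - 5) / β)
    {x G₀ G₁ G₂ G₃ b₁ b₂ b₂' b₃ b₃' : ℝ} (hx : 1 ≤ x) (hG₂ : 0 ≤ G₂) (hG₃ : 0 ≤ G₃) (hb₂0 : 0 ≤ b₂) (hb₂'0 : 0 ≤ b₂')
    (hb₃0 : 0 ≤ b₃) (hb₃'0 : 0 ≤ b₃')
    (hb₁ : ∀ p, ‖fderiv ℝ (frameLevel μ K) p‖ ≤ b₁) (hb₂ : ∀ p, ‖iteratedFDeriv ℝ 2 (frameLevel μ K) p‖ ≤ b₂ + b₂' * x)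
    (hb₃ : ∀ p, ‖iteratedFDeriv ℝ 3 (frameLevel μ K) p‖ ≤ b₃ + b₃' * x)
    (hv₀ : ∀ p, |frameLevel μ K' p - frameLevel μ K p| ≤ G₀ / x ^ 2)
    (hv₁ : ∀ p, ‖fderiv ℝ (fun p => frameLevel μ K' p - frameLevel μ K p) p‖ ≤ G₁ / x)
    (hv₂ : ∀ p, ‖iteratedFDeriv ℝ 2 (fun p => frameLevel μ K' p - frameLevel μ K p) p‖ ≤ G₂)
    (hv₃ : ∀ p, ‖iteratedFDeriv ℝ 3 (fun p => frameLevel μ K' p - frameLevel μ K p) p‖ ≤ G₃ * x)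
    {B₁ B₂ B₃ B₄ : ℝ} (hB₁ : ∀ x, |deriv salmhoferCutoff x| ≤ B₁) (hB₂ : ∀ x, |deriv (deriv salmhoferCutoff) x| ≤ B₂)
    (hB₃ : ∀ x, |deriv (deriv (deriv salmhoferCutoff)) x| ≤ B₃) (hB₄ : ∀ x, |deriv (deriv (deriv (deriv salmhoferCutoff))) x| ≤ B₄)
    -- multiplier data: sup, support, time differences (raw), space differences in scale form
    (Mf : TorusSite 1 (2 * M) × TorusSite 2 L → ℂ) (hM0 : ∀ q, ‖Mf q‖ ≤ 1) {Ns : ℕ} (hsupp : (univ.filter fun q => Mf q ≠ 0).card ≤ Ns)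
    (v : Fin 2 → ℤ) (hv : v ≠ 0)
    {at₁ at₂ at₃ : ℝ} (hat₁ : 0 ≤ at₁) (hat₂ : 0 ≤ at₂) (hat₃ : 0 ≤ at₃)
    (hMt₁ : ∀ q, ‖fwdDiff ((fun _ : Fin 1 => (1 : ZMod (2 * M))), (0 : TorusSite 2 L)) Mf q‖ ≤ at₁)
    (hMt₂ : ∀ q, ‖(fwdDiff ((fun _ : Fin 1 => (1 : ZMod (2 * M))), (0 : TorusSite 2 L)))^[2] Mf q‖ ≤ at₂)
    (hMt₃ : ∀ q, ‖(fwdDiff ((fun _ : Fin 1 => (1 : ZMod (2 * M))), (0 : TorusSite 2 L)))^[3] Mf q‖ ≤ at₃)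
    {α₁ α₂ α₃ : ℝ} (hα₁ : 0 ≤ α₁) (hα₂ : 0 ≤ α₂) (hα₃ : 0 ≤ α₃)
    (hMe₁ : ∀ q (i : Fin 2), ‖fwdDiff ((0 : TorusSite 1 (2 * M)), (Pi.single i (1 : ZMod L) : TorusSite 2 L)) Mf q‖ ≤
      α₁ * ‖(WithLp.toLp 2 (fun j => 2 * π / L * ((Pi.single i (1 : ℤ) : Fin 2 → ℤ) j : ℝ)) : EuclideanSpace ℝ (Fin 2))‖)
    (hMe₂ : ∀ q (i : Fin 2), ‖(fwdDiff ((0 : TorusSite 1 (2 * M)), (Pi.single i (1 : ZMod L) : TorusSite 2 L)))^[2] Mf q‖ ≤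
      α₂ * ‖(WithLp.toLp 2 (fun j => 2 * π / L * ((Pi.single i (1 : ℤ) : Fin 2 → ℤ) j : ℝ)) : EuclideanSpace ℝ (Fin 2))‖ ^ 2)
    (hMe₃ : ∀ q (i : Fin 2), ‖(fwdDiff ((0 : TorusSite 1 (2 * M)), (Pi.single i (1 : ZMod L) : TorusSite 2 L)))^[3] Mf q‖ ≤
      α₃ * ‖(WithLp.toLp 2 (fun j => 2 * π / L * ((Pi.single i (1 : ℤ) : Fin 2 → ℤ) j : ℝ)) : EuclideanSpace ℝ (Fin 2))‖ ^ 3)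
    (hMn₁ : ∀ q, ‖fwdDiff ((0 : TorusSite 1 (2 * M)), (fun j => ((![-v 1, v 0] j : ℤ) : ZMod L))) Mf q‖ ≤
      α₁ * ‖(WithLp.toLp 2 (fun j => 2 * π / L * ((![-v 1, v 0] : Fin 2 → ℤ) j : ℝ)) : EuclideanSpace ℝ (Fin 2))‖)
    (hMn₂ : ∀ q, ‖(fwdDiff ((0 : TorusSite 1 (2 * M)), (fun j => ((![-v 1, v 0] j : ℤ) : ZMod L))))^[2] Mf q‖ ≤
      α₂ * ‖(WithLp.toLp 2 (fun j => 2 * π / L * ((![-v 1, v 0] : Fin 2 → ℤ) j : ℝ)) : EuclideanSpace ℝ (Fin 2))‖ ^ 2)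
    (hMn₃ : ∀ q, ‖(fwdDiff ((0 : TorusSite 1 (2 * M)), (fun j => ((![-v 1, v 0] j : ℤ) : ZMod L))))^[3] Mf q‖ ≤
      α₃ * ‖(WithLp.toLp 2 (fun j => 2 * π / L * ((![-v 1, v 0] : Fin 2 → ℤ) j : ℝ)) : EuclideanSpace ℝ (Fin 2))‖ ^ 3)
    (hMv₁ : ∀ q, ‖fwdDiff ((0 : TorusSite 1 (2 * M)), (fun j => ((v j : ℤ) : ZMod L))) Mf q‖ ≤
      α₁ * ‖(WithLp.toLp 2 (fun j => 2 * π / L * (v j : ℝ)) : EuclideanSpace ℝ (Fin 2))‖)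
    (hMv₂ : ∀ q, ‖(fwdDiff ((0 : TorusSite 1 (2 * M)), (fun j => ((v j : ℤ) : ZMod L))))^[2] Mf q‖ ≤
      α₂ * ‖(WithLp.toLp 2 (fun j => 2 * π / L * (v j : ℝ)) : EuclideanSpace ℝ (Fin 2))‖ ^ 2)
    (hMv₃ : ∀ q, ‖(fwdDiff ((0 : TorusSite 1 (2 * M)), (fun j => ((v j : ℤ) : ZMod L))))^[3] Mf q‖ ≤
      α₃ * ‖(WithLp.toLp 2 (fun j => 2 * π / L * (v j : ℝ)) : EuclideanSpace ℝ (Fin 2))‖ ^ 3)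
    -- rates, the level time condition, the thresholds and the rate conditions
    {s₀ ρ ρ₃ k₁ k₂ k₃ k₄ : ℝ} (hs₀ : 0 < s₀) (hρ : 0 < ρ) (hρ₃ : 0 < ρ₃)
    (hk₁ : k₁ = (16 * B₁ + 16) / Λ ^ 2) (hk₂ : k₂ = (32 * B₂ + 144 * B₁ + 128) / Λ ^ 3)
    (hk₃ : k₃ = (64 * B₃ + 480 * B₂ + 1728 * B₁ + 1536) / Λ ^ 4)
    (hk₄ : k₄ = (128 * B₄ + 1408 * B₃ + 7776 * B₂ + 27648 * B₁ + 24576) / Λ ^ 5)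
    (ht : (2 * π / β) ^ 3 * ((128 * B₄ + 1216 * B₃ + 6912 * B₂ + 26112 * B₁ + 24576) * (β * (L : ℝ) ^ 2) / Λ ^ 5) +
          3 * (at₁ * ((2 * π / β) ^ 2 * ((64 * B₃ + 416 * B₂ + 1600 * B₁ + 1536) * (β * (L : ℝ) ^ 2) / Λ ^ 4))) +
          3 * (at₂ * ((2 * π / β) * ((32 * B₂ + 128 * B₁ + 128) * (β * (L : ℝ) ^ 2) / Λ ^ 3))) + at₃ * ((16 * B₁ + 16) * (β * (L : ℝ) ^ 2) / Λ ^ 2) ≤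
      2 * ((16 * B₁ + 16) * (β * (L : ℝ) ^ 2) / Λ ^ 2) * (4 / (s₀ * (2 * M : ℕ))) ^ 3)
    (hX1 : 3 * (3 * G₁ * k₂ * b₂' + 3 * G₂ * k₁ * α₁ + 3 * G₂ * k₂ * b₁) ≤ k₁ * G₃ * x)
    (hX2 : 3 * (3 * G₀ * k₂ * α₁ * b₂' + 3 * G₀ * k₃ * b₁ * b₂' + 6 * G₁ * k₂ * α₁ * b₁ + 3 * G₁ * k₃ * b₁ ^ 2 + G₀ * G₃ * k₂ + G₀ * k₂ * b₃' + 3 * G₁ * G₂ * k₂ + 3 * G₁ * k₁ * α₂ + 3 * G₁ * k₂ * b₂) ≤ k₁ * G₃ * x ^ 2)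
    (hX3 : 3 * ((3 * G₀ * k₃ * α₁ * b₁ ^ 2 + G₀ * k₄ * b₁ ^ 3 + 3 * G₀ * G₁ * k₃ * b₂' + 3 * G₀ * G₂ * k₂ * α₁ + 3 * G₀ * G₂ * k₃ * b₁ + 3 * G₀ * k₂ * α₁ * b₂ + 3 * G₀ * k₂ * α₂ * b₁ + 3 * G₀ * k₃ * b₁ * b₂ + 3 * G₁ ^ 2 * k₂ * α₁ + 3 * G₁ ^ 2 * k₃ * b₁ + G₀ * k₁ * α₃ + G₀ * k₂ * b₃) + (6 * G₀ * G₁ * k₃ * α₁ * b₁ + 3 * G₀ * G₁ * k₄ * b₁ ^ 2 + 3 * G₀ * G₁ * G₂ * k₃ + 3 * G₀ * G₁ * k₂ * α₂ + 3 * G₀ * G₁ * k₃ * b₂ + G₁ ^ 3 * k₃) + (3 * G₀ * G₁ ^ 2 * k₃ * α₁ + 3 * G₀ * G₁ ^ 2 * k₄ * b₁) + (G₀ * G₁ ^ 3 * k₄)) ≤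
      k₁ * G₃ * x ^ 3)
    (hY1 : 2 * (G₀ * k₂ * b₂' + 2 * G₁ * k₁ * α₁ + 2 * G₁ * k₂ * b₁) ≤ k₁ * G₂ * x)
    (hY2 : 2 * ((2 * G₀ * k₂ * α₁ * b₁ + G₀ * k₃ * b₁ ^ 2 + G₀ * G₂ * k₂ + G₀ * k₁ * α₂ + G₀ * k₂ * b₂ + G₁ ^ 2 * k₂) + (2 * G₀ * G₁ * k₂ * α₁ + 2 * G₀ * G₁ * k₃ * b₁) + (G₀ * G₁ ^ 2 * k₃)) ≤ k₁ * G₂ * x ^ 2)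
    (hrate₃ : G₃ * ρ ^ 3 ≤ (2 / π) ^ 3 * G₀) (hrate₂ : G₂ * ρ₃ ^ 2 ≤ (2 / π) ^ 2 * G₀) :
    ∑ z : TorusSite 1 (2 * M) × TorusSite 2 L,
        (1 + s₀ * |(((z.1 0).valMinAbs : ℤ) : ℝ)| + ρ / x * |(((z.2 0).valMinAbs : ℤ) : ℝ)| + ρ / x * |(((z.2 1).valMinAbs : ℤ) : ℝ)|) *
        ‖∑ q : TorusSite 1 (2 * M) × TorusSite 2 L, (torusChar q.1 z.1 * torusChar q.2 z.2) •
          ((((1 / (β * (L : ℝ) ^ 2) : ℝ) : ℂ) ^ 2 *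
            (Mf q * (sliceSymbolFnXi (β * (L : ℝ) ^ 2) 0 Λ Λ' (matsubaraFreq β M ⟨(q.1 0).val, ZMod.val_lt (q.1 0)⟩) (nambuXiCT L μ K' q.2) -
              sliceSymbolFnXi (β * (L : ℝ) ^ 2) 0 Λ Λ' (matsubaraFreq β M ⟨(q.1 0).val, ZMod.val_lt (q.1 0)⟩) (nambuXiCT L μ K q.2)))))‖ ≤
      x * Real.sqrt (524288 * (1 / s₀ + 1) * ((1 + 4 * Real.sqrt 2) ^ 2 * ((2 * Real.sqrt 2 / ρ + 2) * (2 * Real.sqrt 2 / ρ₃ + 2)) + (1 / ρ + 1) ^ 2)) *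
        Real.sqrt (24 * (2 * M : ℕ) * (L : ℝ) ^ 2 * Ns) * (2 * ((1 / (β * (L : ℝ) ^ 2)) ^ 2 * ((16 * B₁ + 16) * (β * (L : ℝ) ^ 2) / Λ ^ 2 * (G₀ / x ^ 2)))) := by
  classical
  have hL : (0 : ℝ) < L := Nat.cast_pos.2 (Nat.pos_of_ne_zero (NeZero.ne L))
  have hx0 : 0 < x := lt_of_lt_of_le one_pos hx
  have hπ : 0 < π := Real.pi_pos
  set V : ℝ := Real.sqrt ((v 0 : ℝ) ^ 2 + (v 1 : ℝ) ^ 2) with hVdef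
  have hV : 0 < V := sqrt_sq_add_sq_pos_of_ne_zero v hv
  -- nonnegativity of the data
  have hB10 : 0 ≤ B₁ := (abs_nonneg _).trans (hB₁ 0)
  have hB20 : 0 ≤ B₂ := (abs_nonneg _).trans (hB₂ 0)
  have hB30 : 0 ≤ B₃ := (abs_nonneg _).trans (hB₃ 0)
  have hB40 : 0 ≤ B₄ := (abs_nonneg _).trans (hB₄ 0)
  have hb₁0 : 0 ≤ b₁ := le_trans (norm_nonneg _) (hb₁ 0)
  have hG₀ : 0 ≤ G₀ := by
    have h := (abs_nonneg _).trans (hv₀ 0)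
    rwa [le_div_iff₀ (by positivity), zero_mul] at h
  have hG₁ : 0 ≤ G₁ := by
    have h := le_trans (norm_nonneg _) (hv₁ 0)
    rwa [le_div_iff₀ hx0, zero_mul] at h
  have hk₁0 : 0 ≤ k₁ := by rw [hk₁]; positivity
  have hk₂0 : 0 ≤ k₂ := by rw [hk₂]; positivity
  have hk₃0 : 0 ≤ k₃ := by rw [hk₃]; positivity
  have hk₄0 : 0 ≤ k₄ := by rw [hk₄]; positivity
  have hc₀ : 0 ≤ (1 / (β * (L : ℝ) ^ 2)) ^ 2 := by positivity
  have hc : 0 ≤ β * (L : ℝ) ^ 2 := by positivity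
  -- the step norms
  have hηe : ∀ i : Fin 2, ‖(WithLp.toLp 2 (fun j => 2 * π / L * ((Pi.single i (1 : ℤ) : Fin 2 → ℤ) j : ℝ)) : EuclideanSpace ℝ (Fin 2))‖ = 2 * π / L := by
    intro i
    rw [norm_toLp_latticeStep]
    fin_cases i <;> simp
  have hηn : ‖(WithLp.toLp 2 (fun j => 2 * π / L * ((![-v 1, v 0] : Fin 2 → ℤ) j : ℝ)) : EuclideanSpace ℝ (Fin 2))‖ = 2 * π / L * V := by
    rw [norm_toLp_latticeStep, hVdef]
    congr 1
    simp only [Matrix.cons_val_zero, Matrix.cons_val_one, Int.cast_neg]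
    ring_nf
  have hηv : ‖(WithLp.toLp 2 (fun j => 2 * π / L * (v j : ℝ)) : EuclideanSpace ℝ (Fin 2))‖ = 2 * π / L * V := norm_toLp_latticeStep L v
  -- the master increment pair lemma with the solved rates
  have main := sliceIncrPairWt_charSum_l1_le hβ hΛ hΛΛ' hM hb₁ hb₂ hb₃ hv₀ hv₁ hv₂ hv₃ hB₁ hB₂ hB₃ hB₄ Mf hM0 hsupp v hv
    (R₀ := 0) (by push_cast; rw [mul_zero]; exact_mod_cast Nat.pos_of_ne_zero (NeZero.ne L))
    hat₁ hat₂ hat₃ hMt₁ hMt₂ hMt₃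
    (fun i => α₁ * ‖(WithLp.toLp 2 (fun j => 2 * π / L * ((Pi.single i (1 : ℤ) : Fin 2 → ℤ) j : ℝ)) : EuclideanSpace ℝ (Fin 2))‖)
    (fun i => α₂ * ‖(WithLp.toLp 2 (fun j => 2 * π / L * ((Pi.single i (1 : ℤ) : Fin 2 → ℤ) j : ℝ)) : EuclideanSpace ℝ (Fin 2))‖ ^ 2)
    (fun i => α₃ * ‖(WithLp.toLp 2 (fun j => 2 * π / L * ((Pi.single i (1 : ℤ) : Fin 2 → ℤ) j : ℝ)) : EuclideanSpace ℝ (Fin 2))‖ ^ 3)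
    (fun i => by positivity) (fun i => by positivity) (fun i => by positivity) hMe₁ hMe₂ hMe₃
    (by positivity : 0 ≤ α₁ * ‖(WithLp.toLp 2 (fun j => 2 * π / L * ((![-v 1, v 0] : Fin 2 → ℤ) j : ℝ)) : EuclideanSpace ℝ (Fin 2))‖)
    (by positivity : 0 ≤ α₂ * ‖(WithLp.toLp 2 (fun j => 2 * π / L * ((![-v 1, v 0] : Fin 2 → ℤ) j : ℝ)) : EuclideanSpace ℝ (Fin 2))‖ ^ 2)
    (by positivity : 0 ≤ α₃ * ‖(WithLp.toLp 2 (fun j => 2 * π / L * ((![-v 1, v 0] : Fin 2 → ℤ) j : ℝ)) : EuclideanSpace ℝ (Fin 2))‖ ^ 3)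
    hMn₁ hMn₂ hMn₃
    (by positivity : 0 ≤ α₁ * ‖(WithLp.toLp 2 (fun j => 2 * π / L * (v j : ℝ)) : EuclideanSpace ℝ (Fin 2))‖)
    (by positivity : 0 ≤ α₂ * ‖(WithLp.toLp 2 (fun j => 2 * π / L * (v j : ℝ)) : EuclideanSpace ℝ (Fin 2))‖ ^ 2)
    (by positivity : 0 ≤ α₃ * ‖(WithLp.toLp 2 (fun j => 2 * π / L * (v j : ℝ)) : EuclideanSpace ℝ (Fin 2))‖ ^ 3)
    hMv₁ hMv₂ hMv₃
    (A₀ := (2 * ((1 / (β * (L : ℝ) ^ 2)) ^ 2 * ((16 * B₁ + 16) * (β * (L : ℝ) ^ 2) / Λ ^ 2 * (G₀ / x ^ 2)))))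
    (le_mul_of_one_le_left (by positivity) (by norm_num))
    (s₀ := s₀) (s₁ := ρ / x) (s₂ := ρ / x / V) (s₃ := ρ₃ / x / V) (s₃' := ρ / x / V)
    hs₀ (by positivity) (by positivity) (by positivity) (by positivity)
    -- time
    (incr_rate_time_le hc₀ (by positivity) ht)
    -- axes
    (fun i => by
      refine (incr_rate_three_le hc₀ hc hk₁ hk₂ hk₃ hk₄ hk₁0 hk₂0 hk₃0 hk₄0 rfl rfl rfl rfl rfl rfl rfl hG₀ hG₁ hG₂ hG₃ hb₁0 hb₂0 hb₂'0
        hb₃0 hb₃'0 hα₁ hα₂ hα₃ (norm_nonneg _) hx hρ le_rfl le_rfl le_rfl hX1 hX2 hX3 hrate₃).trans_eq ?_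
      rw [hηe i]
      field_simp
      ring)
    -- normal
    (by
      refine (incr_rate_three_le hc₀ hc hk₁ hk₂ hk₃ hk₄ hk₁0 hk₂0 hk₃0 hk₄0 rfl rfl rfl rfl rfl rfl rfl hG₀ hG₁ hG₂ hG₃ hb₁0 hb₂0 hb₂'0
        hb₃0 hb₃'0 hα₁ hα₂ hα₃ (norm_nonneg _) hx hρ le_rfl le_rfl le_rfl hX1 hX2 hX3 hrate₃).trans_eq ?_
      rw [hηn]
      field_simp
      ring)
    -- tangent, order two
    (by
      refine (incr_rate_two_le hc₀ hc hk₁ hk₂ hk₃ hk₁0 hk₂0 hk₃0 rfl rfl rfl rfl rfl hG₀ hG₁ hG₂ hb₁0 hb₂0 hb₂'0 hα₁ hα₂ (norm_nonneg _)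
        hx hρ₃ le_rfl le_rfl hY1 hY2 hrate₂).trans_eq ?_
      rw [hηv]
      field_simp
      ring)
    -- tangent, order three
    (by
      refine (incr_rate_three_le hc₀ hc hk₁ hk₂ hk₃ hk₄ hk₁0 hk₂0 hk₃0 hk₄0 rfl rfl rfl rfl rfl rfl rfl hG₀ hG₁ hG₂ hG₃ hb₁0 hb₂0 hb₂'0
        hb₃0 hb₃'0 hα₁ hα₂ hα₃ (norm_nonneg _) hx hρ le_rfl le_rfl le_rfl hX1 hX2 hX3 hrate₃).trans_eq ?_
      rw [hηv]
      field_simp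
      ring)
  refine main.trans ?_
  -- simplify the prefactor: `(ρ/x/V)·V = ρ/x`, `R₀ = 0`, and pull out `x`
  have e1 : ρ / x / V * V = ρ / x := div_mul_cancel₀ _ hV.ne'
  have e2 : ρ₃ / x / V * V = ρ₃ / x := div_mul_cancel₀ _ hV.ne'
  have hA₀ : 0 ≤ (2 * ((1 / (β * (L : ℝ) ^ 2)) ^ 2 * ((16 * B₁ + 16) * (β * (L : ℝ) ^ 2) / Λ ^ 2 * (G₀ / x ^ 2)))) := by positivity
  have hrad : 524288 * (1 / s₀ + 1) *
      ((1 + 2 * Real.sqrt 2 * (ρ / x) / (ρ / x / V * V) + 2 * Real.sqrt 2 * (ρ / x) / (ρ / x / V * V)) ^ 2 *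
          ((2 * Real.sqrt 2 / (ρ / x / V * V) + 2) * (2 * Real.sqrt 2 / (ρ₃ / x / V * V) + 2)) +
        (1 / (ρ / x) + 1) ^ 2 / (1 + ρ / x * ((0 : ℕ) : ℝ))) ≤
      x ^ 2 * (524288 * (1 / s₀ + 1) * ((1 + 4 * Real.sqrt 2) ^ 2 * ((2 * Real.sqrt 2 / ρ + 2) * (2 * Real.sqrt 2 / ρ₃ + 2)) + (1 / ρ + 1) ^ 2)) := by
    rw [e1, e2, Nat.cast_zero, mul_zero, add_zero, div_one]
    have hρx : 0 < ρ / x := by positivity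
    rw [mul_div_cancel_right₀ _ hρx.ne']
    have i1 : 2 * Real.sqrt 2 / (ρ / x) + 2 ≤ x * (2 * Real.sqrt 2 / ρ + 2) := by
      rw [div_div_eq_mul_div, show x * (2 * Real.sqrt 2 / ρ + 2) = 2 * Real.sqrt 2 * x / ρ + 2 * x by ring]
      linarith only [hx]
    have i2 : 2 * Real.sqrt 2 / (ρ₃ / x) + 2 ≤ x * (2 * Real.sqrt 2 / ρ₃ + 2) := by
      rw [div_div_eq_mul_div, show x * (2 * Real.sqrt 2 / ρ₃ + 2) = 2 * Real.sqrt 2 * x / ρ₃ + 2 * x by ring]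
      linarith only [hx]
    have i3 : (1 / (ρ / x) + 1) ^ 2 ≤ x ^ 2 * (1 / ρ + 1) ^ 2 := by
      rw [← mul_pow]
      apply pow_le_pow_left₀ (by positivity)
      rw [one_div_div, show x * (1 / ρ + 1) = x / ρ + x by ring]
      linarith only [hx]
    have i12 : (2 * Real.sqrt 2 / (ρ / x) + 2) * (2 * Real.sqrt 2 / (ρ₃ / x) + 2) ≤
        x ^ 2 * ((2 * Real.sqrt 2 / ρ + 2) * (2 * Real.sqrt 2 / ρ₃ + 2)) := by
      calc _ ≤ (x * (2 * Real.sqrt 2 / ρ + 2)) * (x * (2 * Real.sqrt 2 / ρ₃ + 2)) := mul_le_mul i1 i2 (by positivity) (by positivity)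
        _ = _ := by ring
    have h1 : 0 ≤ 524288 * (1 / s₀ + 1) := by positivity
    have h2 : 0 ≤ (1 + 2 * Real.sqrt 2 + 2 * Real.sqrt 2) ^ 2 := by positivity
    calc 524288 * (1 / s₀ + 1) * ((1 + 2 * Real.sqrt 2 + 2 * Real.sqrt 2) ^ 2 *
            ((2 * Real.sqrt 2 / (ρ / x) + 2) * (2 * Real.sqrt 2 / (ρ₃ / x) + 2)) + (1 / (ρ / x) + 1) ^ 2)
          ≤ 524288 * (1 / s₀ + 1) * ((1 + 2 * Real.sqrt 2 + 2 * Real.sqrt 2) ^ 2 *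
            (x ^ 2 * ((2 * Real.sqrt 2 / ρ + 2) * (2 * Real.sqrt 2 / ρ₃ + 2))) + x ^ 2 * (1 / ρ + 1) ^ 2) := by
          gcongr
      _ = x ^ 2 * (524288 * (1 / s₀ + 1) * ((1 + 4 * Real.sqrt 2) ^ 2 * ((2 * Real.sqrt 2 / ρ + 2) * (2 * Real.sqrt 2 / ρ₃ + 2)) + (1 / ρ + 1) ^ 2)) := by ring
  have hsq : Real.sqrt (524288 * (1 / s₀ + 1) *
      ((1 + 2 * Real.sqrt 2 * (ρ / x) / (ρ / x / V * V) + 2 * Real.sqrt 2 * (ρ / x) / (ρ / x / V * V)) ^ 2 *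
          ((2 * Real.sqrt 2 / (ρ / x / V * V) + 2) * (2 * Real.sqrt 2 / (ρ₃ / x / V * V) + 2)) +
        (1 / (ρ / x) + 1) ^ 2 / (1 + ρ / x * ((0 : ℕ) : ℝ)))) ≤ x * Real.sqrt (524288 * (1 / s₀ + 1) * ((1 + 4 * Real.sqrt 2) ^ 2 * ((2 * Real.sqrt 2 / ρ + 2) * (2 * Real.sqrt 2 / ρ₃ + 2)) + (1 / ρ + 1) ^ 2)) := by
    refine (Real.sqrt_le_sqrt hrad).trans_eq ?_
    rw [Real.sqrt_mul (by positivity), Real.sqrt_sq hx0.le]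
  exact mul_le_mul_of_nonneg_right (mul_le_mul_of_nonneg_right hsq (Real.sqrt_nonneg _)) hA₀

end Pair

end Summit.HubbardSuperconductivity.HubbardSuperconductivity.Theorems.TorusFourierL2

end
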